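import Summits.CriticalPhenomena.PercolationContinuityZ3.Theorems.PercNearOneGluingNoHeavyLowerTailSwitchRelaxCheck
import HarnessLib

/-!
# `NoHeavyLowerTail` (stmt-CriticalPhenomena-4575) — finite-relaxation replay of switching certificates: the check at one
# input type split by the type of the first passive copy

Support file (prover prim-masterthm-p1 gen 2; `--supports stmt-CriticalPhenomena-4575`).  No named facts, no sorries.

`SwitchRelax.Cert.checkAt c πX` (`…SwitchRelaxCheck`) compares every deduplicated `Y`-signature with every `Z`-signature.
For the larger clean three-copy certificates of the 4-point increasing cubic rows (prim-masterthm-p1, certs-g2/K3clean-inc)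
this single kernel evaluation is too long at the finest input types; `Cert.checkAtY c πX tY` restricts the `Y`-signatures to
those of `Y`-type `tY`, and `Cert.checkAt_of_checkAtY` / `Cert.checkAt_of_piecesY` reassemble the fifteen pieces.
-/

namespace Summit.CriticalPhenomena.PercolationContinuityZ3.Theorems

namespace SwitchRelax

/-- The check at input type `πX` restricted to the `Y`-signatures whose `Y`-type is `tY`. [this work] -/
def Cert.checkAtY (c : Cert) (πX tY : Ty) : Bool :=
  let LY := (dedup ((c.states πX).map (sigY c πX))).filter fun a => a.1 = tY
  let LZ := dedup ((c.states πX).map (sigZ c πX))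
  LY.all fun a => LZ.all fun b => decide (valS c πX a b ≤ 0)

/-- The fifteen restricted checks give the check at `πX`. [this work] -/
theorem Cert.checkAt_of_checkAtY (c : Cert) (πX : Ty) (h : ∀ tY : Ty, c.checkAtY πX tY = true) :
    c.checkAt πX = true := by
  simp only [Cert.checkAt, Cert.checkAtY, List.all_eq_true, List.mem_filter, decide_eq_true_eq] at h ⊢
  intro a ha b hb
  exact h a.1 a ⟨ha, rfl⟩ b hb

/-- The check at `πX` from its fifteen pieces, listed. [this work] -/
theorem Cert.checkAt_of_piecesY (c : Cert) (πX : Ty) (h0 : c.checkAtY πX 0 = true) (h1 : c.checkAtY πX 1 = true)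
    (h2 : c.checkAtY πX 2 = true) (h3 : c.checkAtY πX 3 = true) (h4 : c.checkAtY πX 4 = true)
    (h5 : c.checkAtY πX 5 = true) (h6 : c.checkAtY πX 6 = true) (h7 : c.checkAtY πX 7 = true)
    (h8 : c.checkAtY πX 8 = true) (h9 : c.checkAtY πX 9 = true) (h10 : c.checkAtY πX 10 = true)
    (h11 : c.checkAtY πX 11 = true) (h12 : c.checkAtY πX 12 = true) (h13 : c.checkAtY πX 13 = true)
    (h14 : c.checkAtY πX 14 = true) : c.checkAt πX = true := by
  refine c.checkAt_of_checkAtY πX fun tY => ?_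
  fin_cases tY
  exacts [h0, h1, h2, h3, h4, h5, h6, h7, h8, h9, h10, h11, h12, h13, h14]

end SwitchRelax

end Summit.CriticalPhenomena.PercolationContinuityZ3.Theorems
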